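import Summits.AtomisticToContinuum.Crystallization.Theorems.SlackRigidity.Negative.WitnessBasics
import Literature.MathematicalPhysics.StatisticalMechanics.LennardJonesClusters

/-!
# Line `c-layer-witness-strictness` for crux `SlackRigidity` (stmt-AtomisticToContinuum-11960):
# rooting, part 2 — bad counts under thinning

Helper for the registered stub `stub_rooting` (lead prover).  THINNING (stub `stub_thinning`)
replaces an injective configuration `x` of `N` points by a `1/3`-separated sub-configuration `y`
of `M` of its points.  A particle of `y` that is `(R, ε)`-good in `y` and has NO deleted particle
within distance `R` is `(R, ε)`-good in `x` (`good_of_good_thinned`); since at most `(6R+1)³`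
points of the separated `y` lie within `R` of any deleted particle (packing bound
`card_le_of_separated_of_dist_le`), the bad counts satisfy
`#bad(x) ≤ #bad(y) + (N − M)(1 + (6R+1)³)` (`badCount_le_badCount_thinned`). [folklore]
-/

noncomputable section

namespace Summit.AtomisticToContinuum.Crystallization.Theorems.CLayerWitnessRooting

open scoped BigOperators
open Literature.MathematicalPhysics.StatisticalMechanics
open Summit.AtomisticToContinuum.Crystallization.Theorems.SlackRigidityNegative (E3 Good)

variable {P : PeriodicConfiguration 3} {R ε : ℝ} {N M : ℕ} {x : Fin N → E3} {y : Fin M → E3}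

/-- **Goodness survives un-thinning away from the deleted particles.** If `y` is a
sub-configuration of `x` (`range y ⊆ range x`), `x i = y i'`, `i'` is `(R, ε)`-good in `y`, and every
particle of `x` that is not a particle of `y` is farther than `R` from `x i`, then `i` is
`(R, ε)`-good in `x` (same isometry). [folklore] -/
theorem good_of_good_thinned (hsub : Set.range y ⊆ Set.range x) {i : Fin N} {i' : Fin M}
    (hii' : x i = y i') (hgood : Good P R ε y i')
    (hfar : ∀ j : Fin N, x j ∉ Set.range y → R < dist (x j) (x i)) : Good P R ε x i := by
  obtain ⟨A, ha, hb⟩ := hgood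
  refine ⟨A, fun p hp hpR => ?_, fun j hj => ?_⟩
  · obtain ⟨j', hj'⟩ := ha p hp hpR
    obtain ⟨j, hj⟩ := hsub ⟨j', rfl⟩
    exact ⟨j, by rw [hj, hii']; exact hj'⟩
  · have hjy : x j ∈ Set.range y := by
      by_contra hnot
      exact absurd hj (not_le.2 (hfar j hnot))
    obtain ⟨j', hj'⟩ := hjy
    have hd : dist (y j') (y i') ≤ R := by rw [hj', ← hii']; exact hj
    obtain ⟨p, hp, hjp⟩ := hb j' hd
    exact ⟨p, hp, by rw [← hj', hii']; exact hjp⟩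

/-- In a `1/3`-separated configuration `y`, at most `(6R+1)³` indices `i` of a super-configuration
`x ⊇ y` (injective) carry a `y`-particle within distance `R` of a given point. [folklore] -/
theorem card_filter_mem_range_dist_le (hx : Function.Injective x)
    (hsep : ∀ i j : Fin M, i ≠ j → (1 / 3 : ℝ) ≤ dist (y i) (y j)) (hR : 0 ≤ R) (p : E3) :
    ((Finset.univ.filter fun i : Fin N => x i ∈ Set.range y ∧ dist (x i) p ≤ R).card : ℝ) ≤
      (6 * R + 1) ^ 3 := by
  classical
  set T := Finset.univ.filter fun i : Fin N => x i ∈ Set.range y ∧ dist (x i) p ≤ R with hT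
  have hcard : ((T.image x).card : ℝ) = T.card := by rw [Finset.card_image_of_injective _ hx]
  rw [← hcard]
  have h := card_le_of_separated_of_dist_le (T.image x) p (by norm_num : (0 : ℝ) < 1 / 3) hR ?_ ?_
  · rw [finrank_euclideanSpace_fin] at h
    convert h using 2
    ring
  · intro q hq
    obtain ⟨i, hi, rfl⟩ := Finset.mem_image.1 hq
    exact (Finset.mem_filter.1 hi).2.2
  · intro q hq q' hq' hne
    obtain ⟨i, hi, rfl⟩ := Finset.mem_image.1 hq
    obtain ⟨j, hj, rfl⟩ := Finset.mem_image.1 hq'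
    obtain ⟨i', hi'⟩ := (Finset.mem_filter.1 hi).2.1
    obtain ⟨j', hj'⟩ := (Finset.mem_filter.1 hj).2.1
    rw [← hi', ← hj'] at hne ⊢
    exact hsep i' j' fun h => hne (by rw [h])

/-- **Bad counts under thinning.** If `y` (`M` points, `1/3`-separated) is a sub-configuration of
the injective `x` (`N` points), then for `R ≥ 0`
`#{i : ¬Good(x, i)} ≤ #{i' : ¬Good(y, i')} + (N − M)(1 + (6R+1)³)`: a bad particle of `x` is a
deleted one, or lies within `R` of a deleted one, or is a bad particle of `y`. [folklore] -/
theorem badCount_le_badCount_thinned :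
    ∀ (P : PeriodicConfiguration 3) (R ε : ℝ) {N M : ℕ} {x : Fin N → E3} {y : Fin M → E3},
    Function.Injective x → (∀ i j : Fin M, i ≠ j → (1 / 3 : ℝ) ≤ dist (y i) (y j)) →
    Set.range y ⊆ Set.range x → 0 ≤ R →
    (Nat.card {i : Fin N // ¬ Good P R ε x i} : ℝ) ≤
      Nat.card {i' : Fin M // ¬ Good P R ε y i'} + ((N : ℝ) - M) * (1 + (6 * R + 1) ^ 3) := by
  intro P R ε N M x y hx hsep hsub hR
  classical
  -- the re-indexing map `idx : Fin M → Fin N`, `x (idx i') = y i'`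
  have hidx : ∀ i' : Fin M, ∃ i : Fin N, x i = y i' := fun i' => by
    obtain ⟨i, hi⟩ := hsub ⟨i', rfl⟩
    exact ⟨i, hi⟩
  choose idx hidx using hidx
  have hyinj : Function.Injective y := by
    intro i j hij
    by_contra hne
    have h := hsep i j hne
    rw [hij, dist_self] at h
    linarith
  have hidx_inj : Function.Injective idx := fun i' j' h =>
    hyinj (by rw [← hidx i', ← hidx j', h])
  -- deleted indices and their count
  set D := Finset.univ.filter fun i : Fin N => x i ∉ Set.range y with hD
  have hDc : (Finset.univ.filter fun i : Fin N => x i ∈ Set.range y) = Finset.univ.image idx := by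
    ext i
    simp only [Finset.mem_filter, Finset.mem_univ, true_and, Finset.mem_image]
    constructor
    · rintro ⟨i', hi'⟩
      exact ⟨i', hx (by rw [hidx, hi'])⟩
    · rintro ⟨i', rfl⟩
      exact ⟨i', (hidx i').symm⟩
  have hDcard : (D.card : ℝ) = N - M := by
    have h1 := Finset.card_filter_add_card_filter_not
      (s := (Finset.univ : Finset (Fin N))) (fun i => x i ∈ Set.range y)
    rw [Finset.card_univ, Fintype.card_fin, hDc, Finset.card_image_of_injective _ hidx_inj,
      Finset.card_univ, Fintype.card_fin] at h1
    have h2 : (M : ℝ) + D.card = N := by rw [hD]; exact_mod_cast h1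
    linarith
  -- indices near a deleted particle
  set Near := Finset.univ.filter fun i : Fin N =>
    x i ∈ Set.range y ∧ ∃ d ∈ D, dist (x i) (x d) ≤ R with hNear
  have hNear_sub : Near ⊆ D.biUnion fun d =>
      Finset.univ.filter fun i : Fin N => x i ∈ Set.range y ∧ dist (x i) (x d) ≤ R := by
    intro i hi
    obtain ⟨hiy, d, hd, hdi⟩ := (Finset.mem_filter.1 hi).2
    exact Finset.mem_biUnion.2 ⟨d, hd, Finset.mem_filter.2 ⟨Finset.mem_univ _, hiy, hdi⟩⟩
  have hNear_card : (Near.card : ℝ) ≤ (N - M) * (6 * R + 1) ^ 3 := by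
    calc (Near.card : ℝ)
        ≤ ((D.biUnion fun d => Finset.univ.filter fun i : Fin N =>
            x i ∈ Set.range y ∧ dist (x i) (x d) ≤ R).card : ℝ) := by
          exact_mod_cast Finset.card_le_card hNear_sub
      _ ≤ ∑ d ∈ D, ((Finset.univ.filter fun i : Fin N =>
            x i ∈ Set.range y ∧ dist (x i) (x d) ≤ R).card : ℝ) := by
          exact_mod_cast Finset.card_biUnion_le
      _ ≤ ∑ _d ∈ D, (6 * R + 1) ^ 3 :=
          Finset.sum_le_sum fun d _ => card_filter_mem_range_dist_le hx hsep hR (x d)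
      _ = (N - M) * (6 * R + 1) ^ 3 := by rw [Finset.sum_const, nsmul_eq_mul, hDcard]
  -- bad sets as filters
  set badX := Finset.univ.filter fun i : Fin N => ¬ Good P R ε x i with hbadX
  set badY := Finset.univ.filter fun i' : Fin M => ¬ Good P R ε y i' with hbadY
  have e1 : Nat.card {i : Fin N // ¬ Good P R ε x i} = badX.card := by
    rw [Nat.card_eq_fintype_card, Fintype.card_subtype]
  have e2 : Nat.card {i' : Fin M // ¬ Good P R ε y i'} = badY.card := by
    rw [Nat.card_eq_fintype_card, Fintype.card_subtype]
  -- the key inclusion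
  have hkey : badX ⊆ D ∪ Near ∪ badY.image idx := by
    intro i hi
    have hbad : ¬ Good P R ε x i := (Finset.mem_filter.1 hi).2
    rw [Finset.mem_union, Finset.mem_union]
    by_cases hiy : x i ∈ Set.range y
    · obtain ⟨i', hi'⟩ := hiy
      have hii : idx i' = i := hx (by rw [hidx, hi'])
      by_cases hgood : Good P R ε y i'
      · -- then some deleted particle is within `R`, i.e. `i ∈ Near`
        refine Or.inl (Or.inr ?_)
        by_contra hnn
        apply hbad
        refine good_of_good_thinned hsub hi'.symm hgood fun j hj => ?_
        by_contra hle
        rw [not_lt] at hle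
        apply hnn
        refine Finset.mem_filter.2 ⟨Finset.mem_univ _, ⟨i', hi'⟩, j, ?_, ?_⟩
        · exact Finset.mem_filter.2 ⟨Finset.mem_univ _, hj⟩
        · rwa [dist_comm]
      · exact Or.inr (Finset.mem_image.2 ⟨i', Finset.mem_filter.2 ⟨Finset.mem_univ _, hgood⟩, hii⟩)
    · exact Or.inl (Or.inl (Finset.mem_filter.2 ⟨Finset.mem_univ _, hiy⟩))
  have hcard : badX.card ≤ D.card + Near.card + (badY.image idx).card :=
    (Finset.card_le_card hkey).trans
      ((Finset.card_union_le _ _).trans (Nat.add_le_add_right (Finset.card_union_le _ _) _))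
  have himg : (badY.image idx).card ≤ badY.card := Finset.card_image_le
  rw [e1, e2]
  have h3 : (badX.card : ℝ) ≤ D.card + Near.card + badY.card := by
    exact_mod_cast hcard.trans (Nat.add_le_add_left himg _)
  nlinarith [h3, hNear_card, hDcard]

end Summit.AtomisticToContinuum.Crystallization.Theorems.CLayerWitnessRooting

end
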